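import Summits.PneNP.PneNP.Theorems.SzkEntropyPeaWorstToAvg
import Literature.Computability.MetaComplexity.SamplableMixtures
import Literature.Computability.MetaComplexity.HeuristicClassesHeurBPPReductionProofs
import Literature.Computability.Complexity.PairProjections
import Literature.Computability.Complexity.PromiseProofs

/-!
# PneNP / SzkEntropy — crux `PeaWorstToAvg` (stmt-PneNP-10777): average-case plumbing for
# promise reductions and mixtures (card `lattice-import-trapdoor-support`, first lemmas, PROVED)

Crux-ideate round 1, ideator 2, card `lattice-import-trapdoor-support`
(`Cruxes/PeaWorstToAvg/Ideas/lattice-import-trapdoor-support.md`, sketch `SketchIdeator2.lean`)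
imports average-case hardness INTO `PEA₃` along a Karp promise reduction `Q ≤ PEA₃` (DGRV's
`SZKP_L`-completeness) and lands ONE ensemble from the two query marginals of a `≤ 2`-query
truth-table reduction by a union bound over a fair mixture.  Its two "first lemmas" are pure
average-case plumbing over the tree's `HeurBPP` / `IsPolySamplable` / `PromiseProblem.PolyTimeReducible`;
this file proves both, in slightly more general form:

* `mem_HeurBPP_of_mixture` — a randomized heuristic scheme for `(L, ½K₀ + ½K₁)` is one for
  `(L, K₀)` and for `(L, K₁)` (each component is dominated by the mixture with factor `2`, so this
  is Bogdanov–Trevisan's Lemma 3.2 with the identity reduction; `mem_HeurBPP_of_le_const_mul`);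
  the sketch spells the mixture with Mathlib's deprecated `PMF.bernoulli (1/2)`, which is the tree's
  `mixEnsemble` (`SamplableMixtures.lean`, `PMF.uniformOfFintype Bool`) with the components swapped;
* `exists_hard_samplable_of_polyTimeReducible` — if `Q₁` Karp-reduces to a disjoint promise
  problem `Q₂` and `Q₁` is `HeurBPP`-hard on some polynomial-time samplable ensemble supported on
  its promise, then so is `Q₂`: push the ensemble forward along the reduction
  (`isPolySamplable_map`: `PSamp` is closed under `FP` push-forwards; the push-forward is supported
  on the promise of `Q₂`; and a scheme for `(Q₂.yes, g_* D)` pulls back to one for `(Q₁.yes, D)` by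
  `mem_HeurBPP_of_polyTimeReducible_holds` with domination factor `1`);
  `exists_hard_samplable_pea_of_polyTimeReducible` is the sketch's
  `heurHard_pea_of_heurHard_of_reducible` (its `HeurHard`/`OnPromise` unfolded), for every degree;
* the card's TRANSFER SHAPE for the crux: `peaWorstToAvg_of_hard_reducible` — `PeaWorstToAvg`
  follows as soon as worst-case hardness of `PEA₃` yields SOME promise problem `Q ≤ₚ PEA₃` that is
  `HeurBPP`-hard on a samplable on-promise ensemble (in the card: trapdoor-certified gap-`BDD` under
  worst-case `GapSVP`, via the named facts `blprs_gapSVP_sqrt_dim_to_lwe_classical` /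
  `peikert_gapSVPZeta_to_lwe_classical` and DGRV §4.4 — NOT claimed here), and
  `peaWorstToAvg_of_heurHard_reducible` — unconditionally so if such a `Q` simply exists
  (the "lattice-hard world" case of the card's case split).

References: A. Bogdanov, L. Trevisan, *Average-Case Complexity*, FnT–TCS 2 (2006), Def. 2.1,
2.12–2.13, Def. 3.1 and Lemma 3.2; O. Goldreich, *On promise problems* (2006), Def. 1.4;
Z. Dvir, D. Gutfreund, G. N. Rothblum, S. Vadhan, *On approximating the entropy of polynomial
mappings*, ICS 2011 (ECCC TR10-160), Thm. 1.1, §4.4 and pp. 2–3.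
-/

namespace Summit.PneNP.PneNP.Theorems

open Literature.Computability.Complexity Literature.Computability.MetaComplexity
open _root_.Computability
open scoped ENNReal

/-! ### Parameter-oblivious heuristic reductions along `FP` maps -/

/-- An `FP` map used as a parameter-oblivious reduction map `f(x; n) := g x` is polynomial-time
on the parametrised encoding `⟨x, 1ⁿ⟩` (first pair projection, then `g`).
[BogdanovTrevisan2006, Def. 3.1; AroraBarak2009, §0.1 and §1.3] -/
theorem polyTimeComputable_paramEnc_of_mem_FP {g : List Bool → List Bool} (hg : g ∈ FP) :
    PolyTimeComputable paramEnc (id : List Bool → List Bool)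
      (Function.uncurry fun (x : List Bool) (_ : ℕ) => g x) := by
  have h : PolyTimeComputable (id : List Bool → List Bool) id (g ∘ fun z => (boolUnpair z).1) :=
    PolyTimeComputable.comp_holds hg boolUnpairFst_mem_FP
  refine h.of_encode paramEnc (fun _ => rfl) fun q => ?_
  simp [paramEnc, boolUnpair_boolPair, Function.uncurry]

/-- **A heuristic reduction from an `FP` map and a constant domination factor.** If `g ∈ FP` is
correct on the supports (`g x ∈ L₂ ↔ x ∈ L₁` for `x ∈ supp D₁,ₙ`) and
`Pr_{x ∼ D₁,ₙ}[g x = y] ≤ c · D₂,ₙ(y)`, then `(L₁, D₁) ≤_{AvgP} (L₂, D₂)` (parameter map `n ↦ n`).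
[BogdanovTrevisan2006, Def. 3.1] -/
theorem distPolyTimeReducible_of_mem_FP {Q₁ Q₂ : DistProblem} {g : List Bool → List Bool}
    (hg : g ∈ FP) (hcorr : ∀ n, ∀ x ∈ (Q₁.dist n).support, g x ∈ Q₂.lang ↔ x ∈ Q₁.lang) (c : ℕ)
    (hdom : ∀ (n : ℕ) (y : List Bool),
      (Q₁.dist n).toOuterMeasure {x | g x = y} ≤ (c : ℝ≥0∞) * (Q₂.dist n) y) :
    Q₁.PolyTimeReducible Q₂ := by
  refine ⟨fun x _ => g x, polyTimeComputable_paramEnc_of_mem_FP hg, hcorr, Polynomial.C c,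
    Polynomial.X, fun n y => ?_⟩
  simpa using hdom n y

/-- **`HeurBPP` transfers down a pointwise domination (same language).** If
`D₁,ₙ(y) ≤ c · D₂,ₙ(y)` for all `n, y` and `(L, D₂) ∈ HeurBPP` then `(L, D₁) ∈ HeurBPP`
(Bogdanov–Trevisan's Lemma 3.2 with the identity reduction, via the tree's
`mem_HeurBPP_of_polyTimeReducible_holds`). [BogdanovTrevisan2006, Lemma 3.2] -/
theorem mem_HeurBPP_of_le_const_mul {L : Language Bool} {D₁ D₂ : Ensemble} (c : ℕ)
    (hdom : ∀ (n : ℕ) (y : List Bool), D₁ n y ≤ (c : ℝ≥0∞) * D₂ n y)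
    (h : (⟨L, D₂⟩ : DistProblem) ∈ HeurBPP) : (⟨L, D₁⟩ : DistProblem) ∈ HeurBPP := by
  have hid : (id : List Bool → List Bool) ∈ FP := PolyTimeComputable.id id
  refine mem_HeurBPP_of_polyTimeReducible_holds
    (distPolyTimeReducible_of_mem_FP (Q₁ := ⟨L, D₁⟩) (Q₂ := ⟨L, D₂⟩) hid (fun _ _ _ => Iff.rfl) c
      fun n y => ?_) h
  have hset : {x : List Bool | id x = y} = {y} := by
    ext x
    simp
  dsimp only
  rw [hset, PMF.toOuterMeasure_apply_singleton]
  exact hdom n y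

/-! ### Mixtures -/

/-- A randomized heuristic scheme for `(L, ½K₀ + ½K₁)` is one for `(L, K₀)`.
[BogdanovTrevisan2006, Lemma 3.2; Goldreich2001, §3.2.2] -/
theorem mem_HeurBPP_left_of_mixEnsemble {L : Language Bool} {K₀ K₁ : Ensemble}
    (h : (⟨L, mixEnsemble K₀ K₁⟩ : DistProblem) ∈ HeurBPP) : (⟨L, K₀⟩ : DistProblem) ∈ HeurBPP :=
  mem_HeurBPP_of_le_const_mul 2 (fun n y => by
    have h2 := toOuterMeasure_le_two_mul_mixEnsemble K₀ K₁ n {y} false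
    simpa [PMF.toOuterMeasure_apply_singleton] using h2) h

/-- A randomized heuristic scheme for `(L, ½K₀ + ½K₁)` is one for `(L, K₁)`.
[BogdanovTrevisan2006, Lemma 3.2; Goldreich2001, §3.2.2] -/
theorem mem_HeurBPP_right_of_mixEnsemble {L : Language Bool} {K₀ K₁ : Ensemble}
    (h : (⟨L, mixEnsemble K₀ K₁⟩ : DistProblem) ∈ HeurBPP) : (⟨L, K₁⟩ : DistProblem) ∈ HeurBPP :=
  mem_HeurBPP_of_le_const_mul 2 (fun n y => by
    have h2 := toOuterMeasure_le_two_mul_mixEnsemble K₀ K₁ n {y} true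
    simpa [PMF.toOuterMeasure_apply_singleton] using h2) h

/-- **Union-bound transfer for mixtures (card `lattice-import-trapdoor-support`, first lemma).**
A randomized heuristic scheme for `L` under the fair mixture of `K₀` and `K₁` is a randomized
heuristic scheme for `L` under each component (the component error is at most twice the mixture
error).  This lands ONE ensemble over `PEA₃` instances from the two query marginals of a `≤ 2`-query
truth-table completeness reduction. [BogdanovTrevisan2006, Lemma 3.2; DvirGutfreundRothblumVadhan2010,
Thm. 1.1] -/
theorem mem_HeurBPP_of_mixture (L : Language Bool) (K₀ K₁ : Ensemble)
    (h : DistProblem.mk L (mixEnsemble K₀ K₁) ∈ HeurBPP) :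
    DistProblem.mk L K₀ ∈ HeurBPP ∧ DistProblem.mk L K₁ ∈ HeurBPP :=
  ⟨mem_HeurBPP_left_of_mixEnsemble h, mem_HeurBPP_right_of_mixEnsemble h⟩

/-! ### Push-forwards along Karp promise reductions -/

/-- **`PSamp` is closed under `FP` push-forwards**: if `D` is polynomial-time samplable and
`g ∈ FP` then so is `n ↦ g_* Dₙ` (run the sampler, then `g`; same coin budget).
[BogdanovTrevisan2006, Def. 2.1; Goldreich2001, §3.2.2; AroraBarak2009, §1.3] -/
theorem isPolySamplable_map {D : Ensemble} (hD : D.IsPolySamplable) {g : List Bool → List Bool}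
    (hg : g ∈ FP) : Ensemble.IsPolySamplable fun n => (D n).map g := by
  obtain ⟨S, ⟨hS, p, hp⟩, hout⟩ := hD
  refine ⟨⟨fun n r => g (S.run n r), S.coinLen⟩, ⟨?_, p, hp⟩, fun n => ?_⟩
  · exact PolyTimeComputable.comp_holds hg hS
  · show RandAlg.outputPMF _ unaryEncodeNat n = (D n).map g
    rw [← hout n]
    simp only [RandAlg.outputPMF, PMF.map_comp]
    rfl

/-- The push-forward of an on-promise ensemble along a promise reduction is supported on the
promise of the target problem. [Goldreich2006, Def. 1.4] -/
theorem map_support_subset_promise {Q₁ Q₂ : PromiseProblem} {g : List Bool → List Bool}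
    (hyes : Set.MapsTo g Q₁.yes Q₂.yes) (hno : Set.MapsTo g Q₁.no Q₂.no) {D : Ensemble}
    (hsupp : ∀ n : ℕ, ∀ w ∈ (D n).support, w ∈ Q₁.yes ∨ w ∈ Q₁.no) (n : ℕ) (y : List Bool)
    (hy : y ∈ ((D n).map g).support) : y ∈ Q₂.yes ∨ y ∈ Q₂.no := by
  obtain ⟨x, hx, rfl⟩ := (PMF.mem_support_map_iff _ _ _).1 hy
  rcases hsupp n x hx with h | h
  · exact Or.inl (hyes h)
  · exact Or.inr (hno h)

/-- **Average-case hardness pushes forward along Karp promise reductions.** If `g ∈ FP` reduces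
`Q₁` to the disjoint promise problem `Q₂` and `(Q₁.yes, D) ∉ HeurBPP` for an ensemble `D` supported
on the promise of `Q₁`, then `(Q₂.yes, g_* D) ∉ HeurBPP`: a scheme for the push-forward, run on
`g x`, is a scheme for `D` (correct on the support since `g` respects the promise; domination factor
`1`, as `Pr_{x ∼ Dₙ}[g x = y] = (g_* Dₙ)(y)`). [BogdanovTrevisan2006, Lemma 3.2; Goldreich2006, Def. 1.4] -/
theorem not_mem_HeurBPP_map_of_reduction {Q₁ Q₂ : PromiseProblem} (hQ₂ : Q₂.Disjoint)
    {g : List Bool → List Bool} (hg : g ∈ FP) (hyes : Set.MapsTo g Q₁.yes Q₂.yes)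
    (hno : Set.MapsTo g Q₁.no Q₂.no) {D : Ensemble}
    (hsupp : ∀ n : ℕ, ∀ w ∈ (D n).support, w ∈ Q₁.yes ∨ w ∈ Q₁.no)
    (hD : (⟨Q₁.yes, D⟩ : DistProblem) ∉ HeurBPP) :
    (⟨Q₂.yes, fun n => (D n).map g⟩ : DistProblem) ∉ HeurBPP := by
  intro h
  have hd : Disjoint Q₂.yes Q₂.no := hQ₂
  refine hD (mem_HeurBPP_of_polyTimeReducible_holds
    (distPolyTimeReducible_of_mem_FP (Q₁ := ⟨Q₁.yes, D⟩) (Q₂ := ⟨Q₂.yes, fun n => (D n).map g⟩) hg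
      (fun n x hx => ?_) 1 fun n y => ?_) h)
  · rcases hsupp n x hx with h1 | h1
    · exact ⟨fun _ => h1, fun _ => hyes h1⟩
    · exact ⟨fun h2 => absurd (hno h1) (Set.disjoint_left.1 hd h2),
        fun h3 => absurd (hno h1) (Set.disjoint_left.1 hd (hyes h3))⟩
  · dsimp only
    rw [Nat.cast_one, one_mul, ← PMF.toOuterMeasure_apply_singleton, PMF.toOuterMeasure_map_apply]
    rfl

/-- **Hard samplable ensembles push forward along Karp promise reductions** (the sketch's
`heurHard_pea_of_heurHard_of_reducible` in abstract form, `HeurHard`/`OnPromise` unfolded): if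
`Q₁ ≤ₚ Q₂` with `Q₂` disjoint and `Q₁` is `HeurBPP`-hard on some polynomial-time samplable
ensemble supported on its promise, then so is `Q₂`. [BogdanovTrevisan2006, Lemma 3.2 and Def. 2.1;
Goldreich2006, Def. 1.4] -/
theorem exists_hard_samplable_of_polyTimeReducible {Q₁ Q₂ : PromiseProblem} (hQ₂ : Q₂.Disjoint)
    (hred : Q₁.PolyTimeReducible Q₂)
    (h : ∃ D : Ensemble, D.IsPolySamplable ∧ (∀ n : ℕ, ∀ w ∈ (D n).support, w ∈ Q₁.yes ∨ w ∈ Q₁.no) ∧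
      (⟨Q₁.yes, D⟩ : DistProblem) ∉ HeurBPP) :
    ∃ D : Ensemble, D.IsPolySamplable ∧ (∀ n : ℕ, ∀ w ∈ (D n).support, w ∈ Q₂.yes ∨ w ∈ Q₂.no) ∧
      (⟨Q₂.yes, D⟩ : DistProblem) ∉ HeurBPP := by
  obtain ⟨g, hg, hyes, hno⟩ := hred
  obtain ⟨D, hS, hsupp, hD⟩ := h
  exact ⟨fun n => (D n).map g, isPolySamplable_map hS hg, map_support_subset_promise hyes hno hsupp,
    not_mem_HeurBPP_map_of_reduction hQ₂ hg hyes hno hsupp hD⟩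

/-- **Card `lattice-import-trapdoor-support`, first lemma `heurHard_pea_of_heurHard_of_reducible`,
for every degree:** a promise problem that Karp-reduces to `PEA d` and is `HeurBPP`-hard on a
samplable on-promise ensemble makes `PEA d` `HeurBPP`-hard on a samplable on-promise ensemble.
[DvirGutfreundRothblumVadhan2010, Thm. 1.1 and §4.4; BogdanovTrevisan2006, Lemma 3.2] -/
theorem exists_hard_samplable_pea_of_polyTimeReducible (d : ℕ) {Q : PromiseProblem}
    (hred : Q.PolyTimeReducible (PEA d))
    (h : ∃ D : Ensemble, D.IsPolySamplable ∧ (∀ n : ℕ, ∀ w ∈ (D n).support, w ∈ Q.yes ∨ w ∈ Q.no) ∧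
      (⟨Q.yes, D⟩ : DistProblem) ∉ HeurBPP) :
    ∃ D : Ensemble, D.IsPolySamplable ∧
      (∀ n : ℕ, ∀ w ∈ (D n).support, w ∈ (PEA d).yes ∨ w ∈ (PEA d).no) ∧
      (⟨(PEA d).yes, D⟩ : DistProblem) ∉ HeurBPP :=
  exists_hard_samplable_of_polyTimeReducible (PEA_disjoint d) hred h

/-! ### The card's transfer shape for the crux -/

/-- **Transfer shape of card `lattice-import-trapdoor-support`.** The crux `PeaWorstToAvg`
(stmt-PneNP-10777) follows if worst-case hardness of `PEA₃` yields SOME promise problem that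
Karp-reduces to `PEA₃` and is `HeurBPP`-hard on a polynomial-time samplable ensemble supported on
its promise (in the card: trapdoor-certified gap-`BDD` on `q`-ary lattices, hard under worst-case
`GapSVP` — an input NOT claimed here). [DvirGutfreundRothblumVadhan2010, pp. 2–3 and §4.4] -/
theorem peaWorstToAvg_of_hard_reducible
    (h : PEA 3 ∉ PromiseBPP' → ∃ Q : PromiseProblem, Q.PolyTimeReducible (PEA 3) ∧
      ∃ D : Ensemble, D.IsPolySamplable ∧ (∀ n : ℕ, ∀ w ∈ (D n).support, w ∈ Q.yes ∨ w ∈ Q.no) ∧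
        (⟨Q.yes, D⟩ : DistProblem) ∉ HeurBPP) :
    Summit.PneNP.PneNP.Theses.SzkEntropy.PeaWorstToAvg :=
  szkEntropy_peaWorstToAvg_iff.2 fun hn => by
    obtain ⟨Q, hred, hQ⟩ := h hn
    exact exists_hard_samplable_pea_of_polyTimeReducible 3 hred hQ

/-- **The lattice-hard world closes the crux outright**: if some promise problem reducible to
`PEA₃` is `HeurBPP`-hard on a samplable on-promise ensemble (e.g. under the sibling route's
worst-case lattice thesis), then `PeaWorstToAvg` holds — and so does its hypothesis
`PEA 3 ∉ PromiseBPP'` (by the converse `szkEntropy_peaWorstToAvg_converse`).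
[DvirGutfreundRothblumVadhan2010, pp. 2–3 and §4.4] -/
theorem peaWorstToAvg_of_heurHard_reducible
    (h : ∃ Q : PromiseProblem, Q.PolyTimeReducible (PEA 3) ∧
      ∃ D : Ensemble, D.IsPolySamplable ∧ (∀ n : ℕ, ∀ w ∈ (D n).support, w ∈ Q.yes ∨ w ∈ Q.no) ∧
        (⟨Q.yes, D⟩ : DistProblem) ∉ HeurBPP) :
    Summit.PneNP.PneNP.Theses.SzkEntropy.PeaWorstToAvg ∧ PEA 3 ∉ PromiseBPP' := by
  obtain ⟨Q, hred, hQ⟩ := h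
  have hc := exists_hard_samplable_pea_of_polyTimeReducible 3 hred hQ
  exact ⟨szkEntropy_peaWorstToAvg_iff.2 fun _ => hc, szkEntropy_peaWorstToAvg_converse hc⟩

end Summit.PneNP.PneNP.Theorems
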